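import Mathlib
import Summits.ValiantsHypothesis.ValiantsHypothesis.Cruxes.OrbitDimensionBound.Lines.GaugeLadder

/-!
# F4 ON-PATH file for the rung `Gauge.AffineGaugeShadow` (line `affine_gauge`)

`S → Rung`: `VP_ℂ ≠ VNP_ℂ` implies the rung (`gaugeShadow_of_summit 1`: only `dc(per_n) ≤ m_n` is used), so closing
the rung is NECESSARY for the summit; the kernel's portfolio tactic (`intro h; aesop`) closes it (the lemma is tagged
`@[aesop safe apply]` in the ladder file).  Also recorded: the rung's numeric member feeds the host route's closing
(`closes_floor`-shape with the ORIGINAL crux) and the relaxed closing `closes_affineGauge`.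
[cite: LandsbergRessayre2017, Question 2.2]
-/

set_option linter.dupNamespace false

namespace Summit.ValiantsHypothesis.ValiantsHypothesis.Cruxes.OrbitDimensionBound.Gauge.OnPath

open Summit.ValiantsHypothesis.ValiantsHypothesis.Cruxes.OrbitDimensionBound.Gauge

/-- `S → Rung`. [cite: LandsbergRessayre2017, Question 2.2] -/
theorem rung_of_summit : _root_.ValiantsHypothesis → AffineGaugeShadow :=
  affineGaugeShadow_of_summit

/-- `S → GaugeShadow q` for every gauge degree (the whole dial is on-path). [cite: LandsbergRessayre2017, Question 2.2] -/
example (q : ℕ) : _root_.ValiantsHypothesis → GaugeShadow q :=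
  gaugeShadow_of_summit q

/-- The kernel's portfolio closes `S → Rung`. [cite: LandsbergRessayre2017, Question 2.2] -/
example : _root_.ValiantsHypothesis → AffineGaugeShadow := by
  intro h; aesop

/-- The rung's numeric member closes the host route with the ORIGINAL crux. [cite: LandsbergRessayre2017, Thm. 2.8] -/
example (h₁ : Summit.ValiantsHypothesis.ValiantsHypothesis.Theses.FreeSubtorus.OrbitDimensionBound)
    (h₂ : AffineGaugeCovering) : _root_.ValiantsHypothesis :=
  Summit.ValiantsHypothesis.ValiantsHypothesis.Theses.FreeSubtorus.closes h₁ (subtorusCovering_of_gaugeCovering h₂)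

/-- … and with the RELAXED crux (gauge symmetry in place). [cite: LandsbergRessayre2017, Question 2.2] -/
example (h₁ : OrbitGaugeBound 1) (h₂ : AffineGaugeCovering) : _root_.ValiantsHypothesis :=
  closes_affineGauge h₁ h₂

end Summit.ValiantsHypothesis.ValiantsHypothesis.Cruxes.OrbitDimensionBound.Gauge.OnPath
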